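import Literature.NumberTheory.Weil1965.AdelicFibreMeasuresCutoff
import Literature.NumberTheory.Weil1965.AdelicSiegelFunctionalComplex
import Literature.NumberTheory.Automorphic.AdeleQuotientFourierCoeffBoundFibre
import Literature.NumberTheory.Automorphic.AdelicVectorPlaceSplittingSchwartzBruhatSlices
import Literature.NumberTheory.Automorphic.TateLocalZetaShells
import HarnessLib

/-!
# H413 · E-2 · SW2 (iii) — I-CLOSE step (S-1), generic half: Weil's coefficient extraction for a DIFFERENCE of two positive
# functionals on `𝒮(𝔸_F^m)`, and the frame reading of box-slice masses

Cell `hodgecm-mathlib`, crux H413 (`stmt-HodgeConjecture-24833`), child line `Cruxes/H413/Lines/F0_E2SiegelWeilWeilRange.lean`, stub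
`stub_SW2iii_siegelWeil`, identity half, row (S-1) `hbd_CM` (F0P4-plan (g4) 2026-08-31T04:38Z; seat F0P4-p05 (g2)); consumed by
`Theorems/H413E2SWDilateBoundCM.lean`.  PROOF lane, `--supports stmt-HodgeConjecture-24833 --as helper`.  KERNEL MATHEMATICS ONLY
(theorems; no definition, no `sorry`).  HC_CM is proved only modulo the 7 printed citations until rung 0 closes; nothing here is about Hodge classes.

THE MATHEMATICS ([Weil1965] Chap. IV n° 41 (35), Chap. V n° 50 proof of Thm. 4): a positive functional `S` on `𝒮_ℝ(X)`, `X = 𝔸_F^ι`, carried by the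
rational fibres of a continuous `h : X → 𝔸_F` IS its Radon measure on compactly supported test functions and that measure is the sum of its fibre
measures `μ_b(S)`; so for `E″ = S₁^ℂ − κ₀ S₂^ℂ` and a compactly supported real test function `f`, a bound `‖E″(chirp(β • S) f)‖ ≤ M` uniform in
`β ∈ 𝔸_F` (`h = q_S`) bounds EVERY coefficient: `|μ_b(S₁)(f) − κ₀ μ_b(S₂)(f)| ≤ M` (★ COEFF-b `norm_integral_sub_mul_integral_le_of_fibre_chirp`,
F0P4-p08).  §4 reads the `fr`-pushed-forward box-slice masses of the letter `hbd` (★ (T1)/(T3) of the I-CLOSE) as integrals of the pure tensors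
`𝟙_{β_v⁻¹ A}(x_v) · Θ(placeSplitting (t, x^{(v)}))` (★ TENS-v).

* §1 `rowSum_mul` — the "Borel" condition `b₀₀ + b₀₁ = b₁₀ + b₁₁` of `U(W ⊕ W⁻)` (stabiliser of `W^Δ`) is closed under products.
* §2 `re_add_im_eq_tsum_integral_fibreMeasure` — `S(Re Ψ) + i S(Im Ψ) = Σ_b ∫ Ψ dμ_b(S)` for compactly supported `Ψ ∈ 𝒮`.
* §3 `abs_integral_sub_mul_integral_fibreMeasure_le` — COEFF-b for `E″ = S₁^ℂ − κ₀ S₂^ℂ`.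
* §4 `toReal_setLIntegral_map_frame_eq_integral` — the frame reading.

References: A. Weil, *Sur la formule de Siegel dans la théorie des groupes classiques*, Acta Math. 113 (1965), Chap. IV n° 41 (35) p. 59,
Chap. V n° 47 p. 67, n° 50 pp. 72–74 [Weil1965]; J. W. S. Cassels, A. Fröhlich (eds.), *Algebraic Number Theory* (1967), Ch. XV Lemma 4.2.2
[CasselsFrohlichANT1967]; D. Bump, *Automorphic Forms and Representations* (1997), §3.3 Prop. 3.3.2 [Bump1997].
-/

set_option autoImplicit false
-- the cell's `Summit.HodgeConjecture.HodgeConjecture.…` namespace repeats the summit name by design (D-0017 layout)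
set_option linter.dupNamespace false

noncomputable section

open MeasureTheory NumberField Filter Topology Set IsDedekindDomain
open scoped NNReal ENNReal Matrix ComplexConjugate
open Literature.NumberTheory.Automorphic Literature.NumberTheory.Automorphic.AdelicVector
open Literature.NumberTheory.Weil1964 Literature.NumberTheory.Weil1965
open Literature.NumberTheory.GaloisRepresentations.IsNonarchimedeanLocalField

namespace Summit.HodgeConjecture.HodgeConjecture.Cruxes.H413.E2SWFibreCoeffBound

/-! ## §1 The stabiliser of `W^Δ` is closed under products -/

/-- the row-sum condition `b₀₀ + b₀₁ = b₁₀ + b₁₁` (the Siegel parabolic of `U(W ⊕ W⁻)`: stabiliser of the diagonal line) is multiplicative.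
[cite: Weil1965, Chap. V n° 47, p. 67] -/
theorem rowSum_mul {R : Type*} [CommRing R] (u w : GL (Fin (1 + 1)) R)
    (hu : (u : Matrix (Fin (1 + 1)) (Fin (1 + 1)) R) 0 0 + (u : Matrix (Fin (1 + 1)) (Fin (1 + 1)) R) 0 1 =
      (u : Matrix (Fin (1 + 1)) (Fin (1 + 1)) R) 1 0 + (u : Matrix (Fin (1 + 1)) (Fin (1 + 1)) R) 1 1)
    (hw : (w : Matrix (Fin (1 + 1)) (Fin (1 + 1)) R) 0 0 + (w : Matrix (Fin (1 + 1)) (Fin (1 + 1)) R) 0 1 =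
      (w : Matrix (Fin (1 + 1)) (Fin (1 + 1)) R) 1 0 + (w : Matrix (Fin (1 + 1)) (Fin (1 + 1)) R) 1 1) :
    ((u * w : GL (Fin (1 + 1)) R) : Matrix (Fin (1 + 1)) (Fin (1 + 1)) R) 0 0 +
        ((u * w : GL (Fin (1 + 1)) R) : Matrix (Fin (1 + 1)) (Fin (1 + 1)) R) 0 1 =
      ((u * w : GL (Fin (1 + 1)) R) : Matrix (Fin (1 + 1)) (Fin (1 + 1)) R) 1 0 +
        ((u * w : GL (Fin (1 + 1)) R) : Matrix (Fin (1 + 1)) (Fin (1 + 1)) R) 1 1 := by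
  simp only [Units.val_mul, Matrix.mul_apply, Fin.sum_univ_succ, Fin.sum_univ_zero, Fin.succ_zero_eq_one, add_zero]
  linear_combination ((w : Matrix (Fin (1 + 1)) (Fin (1 + 1)) R) 0 0 + (w : Matrix (Fin (1 + 1)) (Fin (1 + 1)) R) 0 1) * hu -
    ((u : Matrix (Fin (1 + 1)) (Fin (1 + 1)) R) 0 1 - (u : Matrix (Fin (1 + 1)) (Fin (1 + 1)) R) 1 1) * hw

/-! ## §2 A positive functional and its fibre measures on compactly supported complex test functions -/

section Fibres

variable (F : Type) [Field F] [NumberField F] (ι : Type) [Fintype ι]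
  [MeasurableSpace (AdeleRing (𝓞 F) F)] [BorelSpace (AdeleRing (𝓞 F) F)]

/-- **`S(Re Ψ) + i·S(Im Ψ) = Σ_b ∫ Ψ dμ_b(S)`** for a positive functional `S` on `𝒮_ℝ(𝔸_F^ι)` killing functions supported off `h⁻¹(F)`
and a COMPACTLY SUPPORTED `Ψ ∈ 𝒮(𝔸_F^ι)`: the functional is its Radon measure on compactly supported test functions
(★ `integral_schwartzBruhatMeasure_eq_of_hasCompactSupport`) and the measure is the sum of its fibres (★ `integral_schwartzBruhatMeasure_eq_tsum`).
[cite: Weil1965, Chap. IV n° 41, (35) p. 59] -/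
theorem re_add_im_eq_tsum_integral_fibreMeasure (S : piSchwartzBruhatReal F ι →ₗ[ℝ] ℝ)
    (hS : ∀ Ψ : piSchwartzBruhatReal F ι, 0 ≤ (Ψ : (ι → AdeleRing (𝓞 F) F) → ℝ) → 0 ≤ S Ψ)
    (h : (ι → AdeleRing (𝓞 F) F) → AdeleRing (𝓞 F) F) (hh : Continuous h)
    (hS0 : ∀ (Ψ : piSchwartzBruhatReal F ι) (L : Set (ι → AdeleRing (𝓞 F) F)), IsCompact L →
      (∀ x ∈ L, (QuotientAddGroup.mk (h x) : adeleQuotient F) ≠ 0) →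
      tsupport (Ψ : (ι → AdeleRing (𝓞 F) F) → ℝ) ⊆ L → S Ψ = 0)
    (Ψ : piSchwartzBruhat F ι) (hΨc : HasCompactSupport (Ψ : (ι → AdeleRing (𝓞 F) F) → ℂ)) :
    (S ⟨fun x => ((Ψ : (ι → AdeleRing (𝓞 F) F) → ℂ) x).re, re_mem_piSchwartzBruhatReal Ψ.2⟩ : ℂ) +
        Complex.I * (S ⟨fun x => ((Ψ : (ι → AdeleRing (𝓞 F) F) → ℂ) x).im, im_mem_piSchwartzBruhatReal Ψ.2⟩ : ℂ) =
      ∑' b : F, ∫ x, (Ψ : (ι → AdeleRing (𝓞 F) F) → ℂ) x ∂(fibreMeasure F ι S hS h b) := by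
  haveI := secondCountableTopology_adeleRing (K := F)
  haveI : BorelSpace (ι → AdeleRing (𝓞 F) F) := Pi.borelSpace
  haveI := regular_schwartzBruhatMeasure F ι S hS
  have hint : Integrable (Ψ : (ι → AdeleRing (𝓞 F) F) → ℂ) (schwartzBruhatMeasure F ι S hS) :=
    (continuous_of_mem_piSchwartzBruhat Ψ.2).integrable_of_hasCompactSupport hΨc
  have hre := integral_schwartzBruhatMeasure_eq_of_hasCompactSupport F ι S hS
    ⟨fun x => ((Ψ : (ι → AdeleRing (𝓞 F) F) → ℂ) x).re, re_mem_piSchwartzBruhatReal Ψ.2⟩ (hΨc.comp_left Complex.zero_re)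
  have him := integral_schwartzBruhatMeasure_eq_of_hasCompactSupport F ι S hS
    ⟨fun x => ((Ψ : (ι → AdeleRing (𝓞 F) F) → ℂ) x).im, im_mem_piSchwartzBruhatReal Ψ.2⟩ (hΨc.comp_left Complex.zero_im)
  rw [← hre, ← him, ← integral_schwartzBruhatMeasure_eq_tsum F ι S hS h hh hS0 hint]
  show ((∫ x, RCLike.re ((Ψ : (ι → AdeleRing (𝓞 F) F) → ℂ) x) ∂(schwartzBruhatMeasure F ι S hS) : ℝ) : ℂ) +
      Complex.I * ((∫ x, RCLike.im ((Ψ : (ι → AdeleRing (𝓞 F) F) → ℂ) x) ∂(schwartzBruhatMeasure F ι S hS) : ℝ) : ℂ) = _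
  rw [integral_re hint, integral_im hint, RCLike.re_to_complex, RCLike.im_to_complex, mul_comm, Complex.re_add_im]

end Fibres

/-! ## §3 Weil's coefficient extraction for `E″ = S₁^ℂ − κ₀ S₂^ℂ` on a real compactly supported test function -/

section Coeff

variable (F : Type) [Field F] [NumberField F] {m : ℕ}
  [MeasurableSpace (adeleQuotient F)] [BorelSpace (adeleQuotient F)]
  [MeasurableSpace (AdeleRing (𝓞 F) F)] [BorelSpace (AdeleRing (𝓞 F) F)]

/-- **COEFF-b FOR A DIFFERENCE OF TWO POSITIVE FUNCTIONALS.**  `S₁, S₂` positive functionals on `𝒮_ℝ(𝔸_F^m)` carried by the rational fibres of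
`h = q_S` (`hS0₁`, `hS0₂`), `E″(Ψ) = S₁^ℂ(Ψ) − κ₀ S₂^ℂ(Ψ)` (`S^ℂ(Ψ) = S(Re Ψ) + i S(Im Ψ)`), `0 ≤ f ∈ 𝒮_ℝ` compactly supported with complexification
`Ψf`.  If `‖E″(chirp(β•S) Ψf)‖ ≤ M` for ALL `β ∈ 𝔸_F`, then `|μ_b(S₁)(f) − κ₀ μ_b(S₂)(f)| ≤ M` for every `b ∈ F`
(★ `norm_integral_sub_mul_integral_le_of_fibre_chirp` with the fundamental set `univ`).
[cite: Weil1965, Chap. V n° 50, Thm 4, pp. 72–74] [cite: CasselsFrohlichANT1967, Ch. XV Lemma 4.2.2] -/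
theorem abs_integral_sub_mul_integral_fibreMeasure_le (S₁ S₂ : piSchwartzBruhatReal F (Fin m) →ₗ[ℝ] ℝ)
    (hS₁ : ∀ Ψ : piSchwartzBruhatReal F (Fin m), 0 ≤ (Ψ : (Fin m → AdeleRing (𝓞 F) F) → ℝ) → 0 ≤ S₁ Ψ)
    (hS₂ : ∀ Ψ : piSchwartzBruhatReal F (Fin m), 0 ≤ (Ψ : (Fin m → AdeleRing (𝓞 F) F) → ℝ) → 0 ≤ S₂ Ψ)
    (h : (Fin m → AdeleRing (𝓞 F) F) → AdeleRing (𝓞 F) F) (hh : Continuous h)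
    (hS0₁ : ∀ (Ψ : piSchwartzBruhatReal F (Fin m)) (L : Set (Fin m → AdeleRing (𝓞 F) F)), IsCompact L →
      (∀ x ∈ L, (QuotientAddGroup.mk (h x) : adeleQuotient F) ≠ 0) →
      tsupport (Ψ : (Fin m → AdeleRing (𝓞 F) F) → ℝ) ⊆ L → S₁ Ψ = 0)
    (hS0₂ : ∀ (Ψ : piSchwartzBruhatReal F (Fin m)) (L : Set (Fin m → AdeleRing (𝓞 F) F)), IsCompact L →
      (∀ x ∈ L, (QuotientAddGroup.mk (h x) : adeleQuotient F) ≠ 0) →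
      tsupport (Ψ : (Fin m → AdeleRing (𝓞 F) F) → ℝ) ⊆ L → S₂ Ψ = 0)
    (Smat : Matrix (Fin m) (Fin m) (AdeleRing (𝓞 F) F)) (hhS : ∀ x, h x = Literature.NumberTheory.Weil1964.sdForm F Smat x)
    (κ₀ : ℝ) (E'' : piSchwartzBruhat F (Fin m) →ₗ[ℂ] ℂ)
    (hE'' : ∀ Ψ : piSchwartzBruhat F (Fin m), E'' Ψ =
      ((S₁ ⟨fun x => ((Ψ : (Fin m → AdeleRing (𝓞 F) F) → ℂ) x).re, re_mem_piSchwartzBruhatReal Ψ.2⟩ : ℂ) +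
          Complex.I * (S₁ ⟨fun x => ((Ψ : (Fin m → AdeleRing (𝓞 F) F) → ℂ) x).im, im_mem_piSchwartzBruhatReal Ψ.2⟩ : ℂ)) -
        (κ₀ : ℂ) * ((S₂ ⟨fun x => ((Ψ : (Fin m → AdeleRing (𝓞 F) F) → ℂ) x).re, re_mem_piSchwartzBruhatReal Ψ.2⟩ : ℂ) +
          Complex.I * (S₂ ⟨fun x => ((Ψ : (Fin m → AdeleRing (𝓞 F) F) → ℂ) x).im, im_mem_piSchwartzBruhatReal Ψ.2⟩ : ℂ)))
    (f : piSchwartzBruhatReal F (Fin m)) (hfc : HasCompactSupport (f : (Fin m → AdeleRing (𝓞 F) F) → ℝ))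
    (Ψf : piSchwartzBruhat F (Fin m))
    (hΨf : ((Ψf : piSchwartzBruhat F (Fin m)) : (Fin m → AdeleRing (𝓞 F) F) → ℂ) =
      fun x => (((f : (Fin m → AdeleRing (𝓞 F) F) → ℝ) x : ℝ) : ℂ))
    {M : ℝ} (hM : ∀ β : AdeleRing (𝓞 F) F, ‖E'' (chirpLM F (β • Smat) Ψf)‖ ≤ M) (b : F) :
    |(∫ x, (f : (Fin m → AdeleRing (𝓞 F) F) → ℝ) x ∂(fibreMeasure F (Fin m) S₁ hS₁ h b)) -
        κ₀ * ∫ x, (f : (Fin m → AdeleRing (𝓞 F) F) → ℝ) x ∂(fibreMeasure F (Fin m) S₂ hS₂ h b)| ≤ M := by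
  haveI := secondCountableTopology_adeleRing (K := F)
  haveI : BorelSpace (Fin m → AdeleRing (𝓞 F) F) := Pi.borelSpace
  have hΨfc : HasCompactSupport ((Ψf : piSchwartzBruhat F (Fin m)) : (Fin m → AdeleRing (𝓞 F) F) → ℂ) := by
    rw [hΨf]; exact hfc.comp_left Complex.ofReal_zero
  -- the fibre measures are carried by the fibres of `q_S`
  have hfib : ∀ (S : piSchwartzBruhatReal F (Fin m) →ₗ[ℝ] ℝ)
      (hS : ∀ Ψ : piSchwartzBruhatReal F (Fin m), 0 ≤ (Ψ : (Fin m → AdeleRing (𝓞 F) F) → ℝ) → 0 ≤ S Ψ) (b' : F),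
      fibreMeasure F (Fin m) S hS h b' ((Literature.NumberTheory.Weil1964.sdForm F Smat) ⁻¹' {algebraMap F (AdeleRing (𝓞 F) F) b'})ᶜ = 0 := by
    intro S hS b'
    have hpre : (Literature.NumberTheory.Weil1964.sdForm F Smat) ⁻¹' {algebraMap F (AdeleRing (𝓞 F) F) b'} =
        h ⁻¹' {algebraMap F (AdeleRing (𝓞 F) F) b'} := by
      ext x; simp only [Set.mem_preimage, hhS x]
    rw [hpre]; exact fibreMeasure_compl F (Fin m) S hS h hh b'
  -- summability of the fibre integrals of a compactly supported continuous function
  have hsumm : ∀ (S : piSchwartzBruhatReal F (Fin m) →ₗ[ℝ] ℝ)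
      (hS : ∀ Ψ : piSchwartzBruhatReal F (Fin m), 0 ≤ (Ψ : (Fin m → AdeleRing (𝓞 F) F) → ℝ) → 0 ≤ S Ψ)
      (hS0 : ∀ (Ψ : piSchwartzBruhatReal F (Fin m)) (L : Set (Fin m → AdeleRing (𝓞 F) F)), IsCompact L →
        (∀ x ∈ L, (QuotientAddGroup.mk (h x) : adeleQuotient F) ≠ 0) →
        tsupport (Ψ : (Fin m → AdeleRing (𝓞 F) F) → ℝ) ⊆ L → S Ψ = 0)
      (g : (Fin m → AdeleRing (𝓞 F) F) → ℂ), Continuous g → HasCompactSupport g →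
      Summable (fun b' : F => ‖∫ x, g x ∂(fibreMeasure F (Fin m) S hS h b')‖) := by
    intro S hS hS0 g hg hgc
    haveI := regular_schwartzBruhatMeasure F (Fin m) S hS
    have hint : Integrable (fun x => ‖g x‖) (schwartzBruhatMeasure F (Fin m) S hS) :=
      (hg.norm).integrable_of_hasCompactSupport hgc.norm
    rw [← sum_fibreMeasure F (Fin m) S hS h hh hS0] at hint
    have hhas := hasSum_integral_measure hint
    exact hhas.summable.of_nonneg_of_le (fun b' => norm_nonneg _) (fun b' => norm_integral_le_integral_norm _)
  have hcont : Continuous ((Ψf : piSchwartzBruhat F (Fin m)) : (Fin m → AdeleRing (𝓞 F) F) → ℂ) :=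
    continuous_of_mem_piSchwartzBruhat Ψf.2
  have key := norm_integral_sub_mul_integral_le_of_fibre_chirp F Smat (fun b' => fibreMeasure F (Fin m) S₁ hS₁ h b')
    (fun b' => fibreMeasure F (Fin m) S₂ hS₂ h b') (κ₀ : ℂ) (hfib S₁ hS₁) (hfib S₂ hS₂)
    ((Ψf : piSchwartzBruhat F (Fin m)) : (Fin m → AdeleRing (𝓞 F) F) → ℂ) (G := fun β => E'' (chirpLM F (β • Smat) Ψf))
    (fun β => ?_) ?_ (C := Set.univ) (fun x => ⟨0, Set.mem_univ _⟩) (fun β _ => hM β) b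
  · rw [hΨf] at key
    simp only at key
    rw [integral_complex_ofReal, integral_complex_ofReal, ← Complex.ofReal_mul, ← Complex.ofReal_sub, Complex.norm_real, Real.norm_eq_abs] at key
    exact key
  · -- `hG`: the fibre expansion of `E″` on the compactly supported chirped function
    have hc' : HasCompactSupport ((chirpLM F (β • Smat) Ψf : piSchwartzBruhat F (Fin m)) : (Fin m → AdeleRing (𝓞 F) F) → ℂ) := by
      rw [coe_chirpLM]
      have heq : chirp F (β • Smat) ((Ψf : piSchwartzBruhat F (Fin m)) : (Fin m → AdeleRing (𝓞 F) F) → ℂ) =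
          fun x => (adeleAddChar F (β * Literature.NumberTheory.Weil1964.sdForm F Smat x) : ℂ) *
            ((Ψf : piSchwartzBruhat F (Fin m)) : (Fin m → AdeleRing (𝓞 F) F) → ℂ) x :=
        funext fun x => chirp_smul_matrix_apply F β Smat _ x
      rw [heq]; exact hΨfc.mul_left
    have hcc : Continuous ((chirpLM F (β • Smat) Ψf : piSchwartzBruhat F (Fin m)) : (Fin m → AdeleRing (𝓞 F) F) → ℂ) :=
      continuous_of_mem_piSchwartzBruhat (chirpLM F (β • Smat) Ψf).2
    rw [hE'' (chirpLM F (β • Smat) Ψf), re_add_im_eq_tsum_integral_fibreMeasure F (Fin m) S₁ hS₁ h hh hS0₁ _ hc',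
      re_add_im_eq_tsum_integral_fibreMeasure F (Fin m) S₂ hS₂ h hh hS0₂ _ hc', ← tsum_mul_left,
      ← Summable.tsum_sub (hsumm S₁ hS₁ hS0₁ _ hcc hc').of_norm ((hsumm S₂ hS₂ hS0₂ _ hcc hc').of_norm.mul_left _)]
    simp only [coe_chirpLM]
  · -- `hsum`
    refine ((hsumm S₁ hS₁ hS0₁ _ hcont hΨfc).add ((hsumm S₂ hS₂ hS0₂ _ hcont hΨfc).mul_left ‖(κ₀ : ℂ)‖)).of_nonneg_of_le
      (fun _ => norm_nonneg _) (fun b' => ?_)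
    calc ‖(∫ x, ((Ψf : piSchwartzBruhat F (Fin m)) : (Fin m → AdeleRing (𝓞 F) F) → ℂ) x ∂(fibreMeasure F (Fin m) S₁ hS₁ h b')) -
            (κ₀ : ℂ) * ∫ x, ((Ψf : piSchwartzBruhat F (Fin m)) : (Fin m → AdeleRing (𝓞 F) F) → ℂ) x ∂(fibreMeasure F (Fin m) S₂ hS₂ h b')‖
        ≤ ‖∫ x, ((Ψf : piSchwartzBruhat F (Fin m)) : (Fin m → AdeleRing (𝓞 F) F) → ℂ) x ∂(fibreMeasure F (Fin m) S₁ hS₁ h b')‖ +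
            ‖(κ₀ : ℂ) * ∫ x, ((Ψf : piSchwartzBruhat F (Fin m)) : (Fin m → AdeleRing (𝓞 F) F) → ℂ) x ∂(fibreMeasure F (Fin m) S₂ hS₂ h b')‖ :=
          norm_sub_le _ _
      _ = _ := by rw [norm_mul]

end Coeff

/-! ## §4 The box-slice masses of the letter `hbd` are integrals of pure tensors -/

section Frame

variable (F : Type) [Field F] [NumberField F] (ι : Type) [Fintype ι]
  [MeasurableSpace (AdeleRing (𝓞 F) F)] [BorelSpace (AdeleRing (𝓞 F) F)]
  (v : HeightOneSpectrum (𝓞 F))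
  {K : Type*} [Field K] [ValuativeRel K] [TopologicalSpace K] [IsNonarchimedeanLocalField K]
  [MeasurableSpace K] [BorelSpace K]
  {κ : Type*} [Fintype κ]
  (βv : (ι → v.adicCompletion F) ≃ₜ ((κ → K) × (κ → K)))
  (fr : (ι → AdeleRing (𝓞 F) F) ≃ₜ (((κ → K) × (κ → K)) × trivialAt F ι v))
  (he1 : ∀ x, (fr x).1 = βv (evalAt F ι v x))
  (he2 : ∀ x, (fr x).2 = ((placeSplitting F ι v).symm x).2)

include he1 he2 in
/-- **reading the letter's masses**: for a measure `μ` on `X(𝔸_F)` finite on compact sets, a compact open `A ⊆ K^κ × K^κ`, `0 ≤ Θ ∈ 𝒮_ℝ` compactly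
supported and `t ∈ X(F_v)`, the `fr_* μ`-mass of `A × X^{(v)}` weighted by the slice `Θ(t, ·)` is `∫ 𝟙_{β_v⁻¹ A}(x_v) Θ(placeSplitting (t, x^{(v)})) dμ`.
[cite: Weil1965, Chap. V n° 50, p. 74] -/
theorem toReal_setLIntegral_map_frame_eq_integral (μ : Measure (ι → AdeleRing (𝓞 F) F)) [IsFiniteMeasureOnCompacts μ]
    {A : Set ((κ → K) × (κ → K))} (hAo : IsOpen A) (hAc : IsCompact A)
    (Θ : piSchwartzBruhatReal F ι) (hΘ0 : 0 ≤ (Θ : (ι → AdeleRing (𝓞 F) F) → ℝ))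
    (hΘc : HasCompactSupport (Θ : (ι → AdeleRing (𝓞 F) F) → ℝ)) (t : ι → v.adicCompletion F) :
    (∫⁻ z in A ×ˢ (univ : Set (trivialAt F ι v)),
        ENNReal.ofReal ((Θ : (ι → AdeleRing (𝓞 F) F) → ℝ) (placeSplitting F ι v (t, z.2))) ∂(μ.map fr)).toReal =
      ∫ x, (βv ⁻¹' A).indicator (fun _ => (1 : ℝ)) (evalAt F ι v x) *
        (Θ : (ι → AdeleRing (𝓞 F) F) → ℝ) (placeSplitting F ι v (t, ((placeSplitting F ι v).symm x).2)) ∂μ := by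
  classical
  haveI : SecondCountableTopology K := secondCountableTopology_localField K
  haveI : T2Space K := (isLocalField K).toT2Space
  haveI := secondCountableTopology_adeleRing (K := F)
  haveI : BorelSpace (ι → AdeleRing (𝓞 F) F) := Pi.borelSpace
  haveI : BorelSpace (κ → K) := Pi.borelSpace
  haveI : BorelSpace ((κ → K) × (κ → K)) := Prod.borelSpace
  haveI := secondCountableTopology_trivialAt (K := F) (ι := ι) (v := v)
  haveI : BorelSpace (((κ → K) × (κ → K)) × trivialAt F ι v) := Prod.borelSpace
  have hA'o : IsOpen (βv ⁻¹' A) := hAo.preimage βv.continuous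
  have hA'c : IsCompact (βv ⁻¹' A) := βv.isCompact_preimage.2 hAc
  have hgmem := indicator_evalAt_mul_slice_mem_piSchwartzBruhatReal (v := v) Θ.2 t hA'o hA'c
  have hgc := continuous_of_mem_piSchwartzBruhatReal hgmem
  have hgcs := hasCompactSupport_indicator_evalAt_mul_slice (R := ℝ) (v := v) hΘc t hA'c
  have hg0 : ∀ x, 0 ≤ (βv ⁻¹' A).indicator (fun _ => (1 : ℝ)) (evalAt F ι v x) *
      (Θ : (ι → AdeleRing (𝓞 F) F) → ℝ) (placeSplitting F ι v (t, ((placeSplitting F ι v).symm x).2)) :=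
    fun x => mul_nonneg (Set.indicator_nonneg (fun _ _ => zero_le_one) _) (hΘ0 _)
  have hgi := hgc.integrable_of_hasCompactSupport (μ := μ) hgcs
  rw [integral_eq_lintegral_of_nonneg_ae (Eventually.of_forall hg0) hgi.aestronglyMeasurable]
  congr 1
  have hcoe : (⇑fr.toMeasurableEquiv : (ι → AdeleRing (𝓞 F) F) → ((κ → K) × (κ → K)) × trivialAt F ι v) = ⇑fr :=
    Homeomorph.toMeasurableEquiv_coe fr
  rw [← hcoe, MeasurableEquiv.restrict_map, lintegral_map_equiv, hcoe]
  have hpre : ⇑fr ⁻¹' (A ×ˢ (univ : Set (trivialAt F ι v))) = (evalAt F ι v) ⁻¹' (βv ⁻¹' A) := by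
    ext x
    simp only [Set.mem_preimage, Set.mem_prod, Set.mem_univ, and_true, he1 x]
  have hmeas : MeasurableSet ((evalAt F ι v) ⁻¹' (βv ⁻¹' A)) :=
    (hA'o.preimage (continuous_evalAt F ι v)).measurableSet
  rw [hpre, ← lintegral_indicator hmeas]
  refine lintegral_congr fun x => ?_
  by_cases hx : x ∈ (evalAt F ι v) ⁻¹' (βv ⁻¹' A)
  · rw [Set.indicator_of_mem hx, Set.indicator_of_mem (Set.mem_preimage.1 hx), one_mul, he2 x]
  · rw [Set.indicator_of_notMem hx, Set.indicator_of_notMem (fun h' => hx (Set.mem_preimage.2 h')), zero_mul,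
      ENNReal.ofReal_zero]

end Frame

end Summit.HodgeConjecture.HodgeConjecture.Cruxes.H413.E2SWFibreCoeffBound

end
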